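import Literature.Barriers.QuantumAdvantage.TensorNetworkContractionSegmentsTreewidth
import Literature.LinearAlgebra.TensorNetworks.JunctionTreeBridge
import Literature.Combinatorics.SimpleGraph.TreeDecompositionRooting
import Literature.Combinatorics.SimpleGraph.ListTreeDecompositionSeparators
import Literature.Computability.QuantumComplexity.ZOmegaCramer
import Literature.Computability.QuantumComplexity.CliffordTPathSums
import HarnessLib

/-!
# Barrier catalogue `QuantumAdvantage` — the segment network of a Clifford+T circuit as integer records

Companion to `TensorNetworkContraction*.lean` (Markov–Shi, Prop. 3.5 / Thm. 4.6). The machine of the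
discharge of `markovShi2008_prop51` / `markovShi2008_thm46` evaluates the segment tensor network
`N(C; x, τ)` (`TensorNetworkContractionSegments.lean`: indices = wire segments with values in
`Bool × Bool`, tensors = circuit nodes) by the junction-tree algorithm of
`Literature/LinearAlgebra/TensorNetworks/JunctionTree.lean`, which runs on LIST networks over a
commutative semiring: variables and values are naturals, factors are symbols with a scope and an
entry function. This file is that list network for a Clifford+T circuit, over the ring `ℤ[ω]`
(`ZOmega`, exact arithmetic) with every Hadamard tensor rescaled by `2` so that all entries are in
`ℤ[ω]` (Markov–Shi: "the deterministic simulation computes the probability exactly"; for Clifford+T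
the entries of `U ⊗ Ū` lie in `½ℤ[ω]`):

* `domCode : Bool × Bool ≃ Fin 4`, `ketOf`, `braOf` (reading a value code);
* `NodeRec` — the record of a tensor: `input s bit`, `gateH/S/T sIn sOut`, `gateCNOT cIn tIn cOut tOut`,
  `output s measured`, `dead` (oracle gates, absent from oracle-free circuits) — with `NodeRec.scope`,
  **`NodeRec.eval : NodeRec → (ℕ → ℕ) → ZOmega`** (the entry functions the machine computes),
  `NodeRec.eval_congr` (locality), `recOps`;
* for a circuit `C` on `N` wires with `T` gates, an input `z₀` and a measured wire `w₀`: the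
  segment list `segList` (wire-major) and numbering `segIdx : Seg C ≃ Fin (segCount C)` (position
  in the list — what a machine computes), `recOf C z₀ w₀ : CircuitNode T N → NodeRec`,
  `nodeList`, `recList`; `scope_recOf_subset` (record scopes are numbered tensor scopes);
* **`val_eval_recOf`**: read through `ZOmega.val`, the record entry is the entry of
  `segmentNetwork C A z₀ obs` times `2` for Hadamard nodes (`recWeight`), `1` otherwise — the four
  gate computations `H ⊗ H̄`, `S ⊗ S̄`, `T ⊗ T̄`, `CNOT ⊗ CNOT` on segment values;
* **`val_netValue_recList`**: `val (netValue) = (∏ recWeight) · (segmentNetwork …).value`, hence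
  **`val_netValue_recList_eq_acceptProb`** (Prop. 3.5, `acceptProb_eq_value_segmentNetwork`).

The treewidth side (a rooted list decomposition of the record graph from `tw(G_C)`, the Helly
housing of scopes, and `dpValue = netValue`) is `TensorNetworkContractionRecordsDP.lean`.

## References

* [MarkovShi2008] I. L. Markov, Y. Shi, SIAM J. Comput. 38 (2008) 963–981, §3 (Def. 3.2: the
  tensor of a superoperator `ρ ↦ UρU†`, entries `U_{a,b} conj U_{a',b'}`; Prop. 3.5), §4 (Thm. 4.6).
* M. A. Nielsen, I. L. Chuang, *Quantum Computation and Quantum Information*, CUP 2010, §4.2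
  (the matrices of `H`, `S`, `T`, `CNOT`).
-/

noncomputable section

namespace Literature.Barriers.QuantumAdvantage

open Literature.Computability.Cryptography Literature.Computability.QuantumComplexity
  Literature.LinearAlgebra.TensorNetworks Literature.LinearAlgebra.TensorNetworks.JT
  Literature.Combinatorics.SimpleGraph Literature.Combinatorics.SimpleGraph.ListTD

/-! ### Value codes -/

/-- **The code of an index value** (ket bit, bra bit): `2·[ket] + [bra] ∈ {0, 1, 2, 3}`. [folklore] -/
def domCode : Bool × Bool ≃ Fin 4 where
  toFun p := ⟨(if p.1 then 2 else 0) + (if p.2 then 1 else 0), by rcases p with ⟨_ | _, _ | _⟩ <;> decide⟩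
  invFun x := (decide (2 ≤ (x : ℕ)), decide ((x : ℕ) % 2 = 1))
  left_inv p := by rcases p with ⟨_ | _, _ | _⟩ <;> decide
  right_inv x := by fin_cases x <;> decide

/-- **The ket bit of a value code** (junk beyond `3`). [folklore] -/
def ketOf (x : ℕ) : Bool := decide (2 ≤ x)

/-- **The bra bit of a value code.** [folklore] -/
def braOf (x : ℕ) : Bool := decide (x % 2 = 1)

/-- Reading the ket bit back. [folklore] -/
@[simp] theorem ketOf_domCode (p : Bool × Bool) : ketOf (domCode p) = p.1 := by
  rcases p with ⟨_ | _, _ | _⟩ <;> decide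

/-- Reading the bra bit back. [folklore] -/
@[simp] theorem braOf_domCode (p : Bool × Bool) : braOf (domCode p) = p.2 := by
  rcases p with ⟨_ | _, _ | _⟩ <;> decide

/-! ### Records and their entries over `ℤ[ω]` -/

/-- **The record of a tensor of the segment network**: the input tensor of a wire (its first
segment and the input bit), a one-qubit gate tensor (segments before and after), a `CNOT` tensor
(control/target segments before and after), the output tensor of a wire (its last segment, whether
the wire is the measured one), or a dead record (an oracle gate; never present for oracle-free
circuits). [cite: MarkovShi2008, §3 (the network N(C; x, τ), Def 3.2 and Def 3.4)] -/
inductive NodeRec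
  /-- input tensor `|bit⟩⟨bit|` on segment `s` -/
  | input (s : ℕ) (bit : Bool)
  /-- Hadamard superoperator tensor (rescaled by `2`) -/
  | gateH (sIn sOut : ℕ)
  /-- phase-gate superoperator tensor -/
  | gateS (sIn sOut : ℕ)
  /-- `π/8`-gate superoperator tensor -/
  | gateT (sIn sOut : ℕ)
  /-- `CNOT` superoperator tensor -/
  | gateCNOT (cIn tIn cOut tOut : ℕ)
  /-- output tensor: trace, or the effect "reads `1`" on the measured wire -/
  | output (s : ℕ) (measured : Bool)
  /-- a dead record (oracle gate), entry `0` -/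
  | dead
  deriving DecidableEq

namespace NodeRec

/-- **The scope of a record** (the segments it reads). [cite: MarkovShi2008, §3 (Def 3.3: the indices of a tensor)] -/
def scope : NodeRec → List ℕ
  | input s _ => [s]
  | gateH i o => [i, o]
  | gateS i o => [i, o]
  | gateT i o => [i, o]
  | gateCNOT cIn tIn cOut tOut => [cIn, tIn, cOut, tOut]
  | output s _ => [s]
  | dead => []

/-- The element `ω` of `ℤ[ω]`. [folklore] -/
def om : ZOmega := ⟨0, 1⟩

/-- `val ω = e^{iπ/4}`. [folklore] -/
@[simp] theorem val_om : ZOmega.val om = omega := by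
  rw [ZOmega.val_apply]; simp [om]

/-- **The entry of a record at an assignment** (values read as codes of (ket, bra) bit pairs):
`input`: `[ket = bra = bit]`; `gateH`: `(-1)^{ketIn ketOut + braIn braOut}` (`2 · H⊗H̄`);
`gateS`: `[ketIn = ketOut][braIn = braOut] ω^{2 ketIn + 6 braIn}` (`i^{k} (-i)^{b}`);
`gateT`: `[…][…] ω^{ketIn + 7 braIn}` (`ω^{k} ω̄^{b}`); `gateCNOT`: the permutation
`|c, t⟩ ↦ |c, t ⊕ c⟩` on kets and on bras; `output`: `[ket = bra]`, and `[ket = 1]` if measured.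
[cite: MarkovShi2008, §3 (Def 3.2: entries U_{a,b} conj U_{a',b'}; Def 3.4)] -/
def eval : NodeRec → (ℕ → ℕ) → ZOmega
  | input s bit, a => if ketOf (a s) = bit ∧ braOf (a s) = bit then 1 else 0
  | gateH i o, a => if ((ketOf (a i) && ketOf (a o)) ^^ (braOf (a i) && braOf (a o))) then -1 else 1
  | gateS i o, a => if ketOf (a i) = ketOf (a o) ∧ braOf (a i) = braOf (a o) then
      om ^ (2 * (if ketOf (a i) then 1 else 0) + 6 * (if braOf (a i) then 1 else 0)) else 0
  | gateT i o, a => if ketOf (a i) = ketOf (a o) ∧ braOf (a i) = braOf (a o) then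
      om ^ ((if ketOf (a i) then 1 else 0) + 7 * (if braOf (a i) then 1 else 0)) else 0
  | gateCNOT cIn tIn cOut tOut, a =>
      if (ketOf (a cOut) = ketOf (a cIn) ∧ ketOf (a tOut) = (ketOf (a tIn) ^^ ketOf (a cIn))) ∧
          (braOf (a cOut) = braOf (a cIn) ∧ braOf (a tOut) = (braOf (a tIn) ^^ braOf (a cIn))) then 1 else 0
  | output s m, a => if ketOf (a s) = braOf (a s) ∧ (m = true → ketOf (a s) = true) then 1 else 0
  | dead, _ => 0

/-- **Locality**: the entry depends only on the values of the scope. [folklore] -/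
theorem eval_congr (r : NodeRec) {a b : ℕ → ℕ} (h : ∀ v ∈ r.scope, a v = b v) : r.eval a = r.eval b := by
  cases r with
  | input s bit => simp only [scope, List.mem_singleton, forall_eq] at h; simp only [eval, h]
  | gateH i o =>
    simp only [scope, List.mem_cons, forall_eq_or_imp] at h
    simp only [eval, h.1, h.2]
  | gateS i o =>
    simp only [scope, List.mem_cons, forall_eq_or_imp] at h
    simp only [eval, h.1, h.2]
  | gateT i o =>
    simp only [scope, List.mem_cons, forall_eq_or_imp] at h
    simp only [eval, h.1, h.2]
  | gateCNOT cIn tIn cOut tOut =>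
    simp only [scope, List.mem_cons, forall_eq_or_imp] at h
    simp only [eval, h.1, h.2.1, h.2.2.1, h.2.2.2]
  | output s m => simp only [scope, List.mem_singleton, forall_eq] at h; simp only [eval, h]
  | dead => rfl

/-- **The `FactorOps` of records** for the junction-tree engine. [folklore] -/
def recOps : FactorOps ZOmega NodeRec where
  scope := scope
  feval := eval

/-- Whether a record is a (rescaled) Hadamard tensor. [folklore] -/
def isH : NodeRec → Bool
  | gateH _ _ => true
  | _ => false

end NodeRec

/-! ### The records of a circuit -/

variable {N : ℕ}

/-- **The list of segments**, wire by wire and, on a wire, by starting boundary (the order in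
which a machine enumerates them from the gate list). [cite: MarkovShi2008, §3 (the wires of N(C))] -/
def segList (C : QCircuit cliffordT N) : List (Seg C) :=
  (List.finRange N).flatMap fun w =>
    ((List.finRange (C.gates.length + 1)).filter fun t : Fin (C.gates.length + 1) =>
      decide (canon C w (t : ℕ) = (t : ℕ))).map fun t => segAt C w t

/-- Every segment is listed. [folklore] -/
theorem mem_segList (C : QCircuit cliffordT N) (s : Seg C) : s ∈ segList C := by
  rw [segList, List.mem_flatMap]
  refine ⟨s.1.1, List.mem_finRange _, List.mem_map.2 ⟨s.1.2, ?_, segAt_self s⟩⟩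
  exact List.mem_filter.2 ⟨List.mem_finRange _, by simpa using s.2⟩

/-- The segment list has no repetition. [folklore] -/
theorem nodup_segList (C : QCircuit cliffordT N) : (segList C).Nodup := by
  rw [segList, List.nodup_flatMap]
  constructor
  · intro w _
    refine List.Nodup.map_on (fun t ht t' ht' h => ?_) ((List.nodup_finRange _).filter _)
    have h1 : canon C w (t : ℕ) = (t : ℕ) := by simpa using (List.mem_filter.1 ht).2
    have h2 : canon C w (t' : ℕ) = (t' : ℕ) := by simpa using (List.mem_filter.1 ht').2
    have := congrArg (fun s : Seg C => (s.1.2 : ℕ)) h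
    simp only [segAt] at this
    exact Fin.ext (by rw [← h1, ← h2]; exact this)
  · refine (List.nodup_finRange N).pairwise_of_forall_ne fun w _ w' _ hww' => ?_
    simp only [Function.onFun, List.disjoint_left, List.mem_map, not_exists, not_and]
    rintro s ⟨t, -, rfl⟩ t' - h
    exact hww' (by simpa [segAt] using congrArg (fun s : Seg C => s.1.1) h.symm)

/-- **The number of segments** of a circuit. [folklore] -/
def segCount (C : QCircuit cliffordT N) : ℕ := (segList C).length

/-- **The numbering of the segments**: the position in `segList`. [folklore] -/
def segIdx (C : QCircuit cliffordT N) : Seg C ≃ Fin (segCount C) :=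
  (List.Nodup.getEquivOfForallMemList (segList C) (nodup_segList C) (mem_segList C)).symm

/-- The segment with a given number is the list entry. [folklore] -/
theorem segList_getElem_segIdx (C : QCircuit cliffordT N) (s : Seg C) :
    (segList C)[(segIdx C s : ℕ)]'(segIdx C s).isLt = s :=
  (List.Nodup.getEquivOfForallMemList (segList C) (nodup_segList C) (mem_segList C)).apply_symm_apply s

/-- The number of a segment, as a natural. [folklore] -/
def sn (C : QCircuit cliffordT N) (w : Fin N) (t : Fin (C.gates.length + 1)) : ℕ := segIdx C (segAt C w t)

/-- **The record of a circuit node** (input `z₀`, measured wire `w₀`).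
[cite: MarkovShi2008, §3 (the network N(C; x, τ))] -/
def recOf (C : QCircuit cliffordT N) (z₀ : QReg N) (w₀ : Fin N) : CircuitNode C.gates.length N → NodeRec
  | .input w => .input (sn C w 0) (z₀ w)
  | .gate t =>
    match C.gates[(t : ℕ)] with
    | .gate .H e => .gateH (sn C (embH e 0) t.castSucc) (sn C (embH e 0) t.succ)
    | .gate .S e => .gateS (sn C (embS e 0) t.castSucc) (sn C (embS e 0) t.succ)
    | .gate .T e => .gateT (sn C (embT e 0) t.castSucc) (sn C (embT e 0) t.succ)
    | .gate .CNOT e => .gateCNOT (sn C (embC e 0) t.castSucc) (sn C (embC e 1) t.castSucc)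
        (sn C (embC e 0) t.succ) (sn C (embC e 1) t.succ)
    | .oracle _ _ => .dead
  | .output w => .output (sn C w (Fin.last _)) (decide (w = w₀))

/-- **The list of circuit nodes**: inputs, gates, outputs. [folklore] -/
def nodeList (T N : ℕ) : List (CircuitNode T N) :=
  (List.finRange N).map CircuitNode.input ++ (List.finRange T).map CircuitNode.gate ++
    (List.finRange N).map CircuitNode.output

/-- The node list has no repetition. [folklore] -/
theorem nodup_nodeList (T N : ℕ) : (nodeList T N).Nodup := by
  refine List.Nodup.append (List.Nodup.append ?_ ?_ ?_) ?_ ?_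
  · exact (List.nodup_finRange N).map fun _ _ h => by injection h
  · exact (List.nodup_finRange T).map fun _ _ h => by injection h
  · intro x h1 h2
    obtain ⟨w, -, rfl⟩ := List.mem_map.1 h1
    obtain ⟨t, -, h⟩ := List.mem_map.1 h2
    cases h
  · exact (List.nodup_finRange N).map fun _ _ h => by injection h
  · intro x h1 h2
    obtain ⟨w, -, rfl⟩ := List.mem_map.1 h2
    rcases List.mem_append.1 h1 with h | h
    · obtain ⟨w', -, h'⟩ := List.mem_map.1 h; cases h'
    · obtain ⟨t, -, h'⟩ := List.mem_map.1 h; cases h'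

/-- Every node is listed. [folklore] -/
theorem mem_nodeList {T N : ℕ} (u : CircuitNode T N) : u ∈ nodeList T N := by
  cases u with
  | input w => exact List.mem_append_left _ (List.mem_append_left _ (List.mem_map_of_mem (List.mem_finRange w)))
  | gate t => exact List.mem_append_left _ (List.mem_append_right _ (List.mem_map_of_mem (List.mem_finRange t)))
  | output w => exact List.mem_append_right _ (List.mem_map_of_mem (List.mem_finRange w))

/-- **The record list of a circuit.** [cite: MarkovShi2008, §3 (the network N(C; x, τ))] -/
def recList (C : QCircuit cliffordT N) (z₀ : QReg N) (w₀ : Fin N) : List NodeRec :=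
  (nodeList C.gates.length N).map (recOf C z₀ w₀)

/-- The effects of the measurement scenario "wire `w₀` reads `1`", all other wires traced out.
[cite: MarkovShi2008, §3 (Def 3.4)] -/
def obsOf (w₀ : Fin N) : Fin N → Bool → ℂ := fun w b => if w = w₀ then (if b then 1 else 0) else 1

/-- **The rescaling constant** of a node: `2` for a Hadamard gate, `1` otherwise. [folklore] -/
def recWeight (C : QCircuit cliffordT N) (u : CircuitNode C.gates.length N) : ℂ :=
  match u with
  | .gate t => match C.gates[(t : ℕ)] with
    | .gate .H _ => 2
    | _ => 1
  | _ => 1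

/-! ### Reading the encoded assignment -/

section Entries

variable (C : QCircuit cliffordT N)

/-- The ket bit of a segment under the encoded assignment. [folklore] -/
theorem ketOf_enc (g : Seg C → Bool × Bool) (w : Fin N) (t : Fin (C.gates.length + 1)) :
    ketOf (encodeAssign (segIdx C) domCode g (sn C w t)) = ketAt g t w := by
  rw [sn, encodeAssign_apply, ketOf_domCode]; rfl

/-- The bra bit of a segment under the encoded assignment. [folklore] -/
theorem braOf_enc (g : Seg C → Bool × Bool) (w : Fin N) (t : Fin (C.gates.length + 1)) :
    braOf (encodeAssign (segIdx C) domCode g (sn C w t)) = braAt g t w := by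
  rw [sn, encodeAssign_apply, braOf_domCode]; rfl

variable {C}

/-- On a wire the gate does not act on, the register states before and after agree (kets).
[folklore] -/
theorem ketAt_succ_of_not_mem (g : Seg C → Bool × Bool) (t : Fin C.gates.length) {w : Fin N}
    (hw : w ∉ (C.gates[(t : ℕ)]).wires) : ketAt g t.succ w = ketAt g t.castSucc w := by
  unfold ketAt; rw [segAt_succ_of_not_mem t hw]

/-- On a wire the gate does not act on, the register states before and after agree (bras).
[folklore] -/
theorem braAt_succ_of_not_mem (g : Seg C → Bool × Bool) (t : Fin C.gates.length) {w : Fin N}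
    (hw : w ∉ (C.gates[(t : ℕ)]).wires) : braAt g t.succ w = braAt g t.castSucc w := by
  unfold braAt; rw [segAt_succ_of_not_mem t hw]

/-- **The entry of a gate tensor**, for a placed gate symbol: the gate matrix on the restrictions
to its wires, times the conjugate on the bra side. [cite: MarkovShi2008, §3 (Def 3.2)] -/
theorem entry_gate_eq (A : Language Bool) (z₀ : QReg N) (obs : Fin N → Bool → ℂ) (g : Seg C → Bool × Bool)
    (t : Fin C.gates.length) {op : CliffordTOp} {e : Fin (cliffordT.arity op) ↪ Fin N}
    (hg : C.gates[(t : ℕ)] = QGate.gate op e) :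
    (segmentNetwork C A z₀ obs).entry (.gate t) g =
      cliffordT.mat op (fun j => ketAt g t.succ (e j)) (fun j => ketAt g t.castSucc (e j)) *
        starRingEnd ℂ (cliffordT.mat op (fun j => braAt g t.succ (e j)) (fun j => braAt g t.castSucc (e j))) := by
  have hwires : ∀ i, i ∉ Set.range e → i ∉ (C.gates[(t : ℕ)]).wires := by
    intro i hi hmem
    rw [hg, QGate.wires] at hmem
    obtain ⟨j, -, rfl⟩ := Finset.mem_map.1 hmem
    exact hi ⟨j, rfl⟩
  show (C.gates[(t : ℕ)]).toMatrix A (ketAt g t.succ) (ketAt g t.castSucc) *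
      (starRingEnd ℂ) ((C.gates[(t : ℕ)]).toMatrix A (braAt g t.succ) (braAt g t.castSucc)) = _
  rw [hg, QGate.toMatrix_gate, placeGate_apply, placeGate_apply,
    if_pos fun i hi => ketAt_succ_of_not_mem g t (hwires i hi), if_pos fun i hi => braAt_succ_of_not_mem g t (hwires i hi)]
  rfl

/-- Equality of one-qubit register states is equality of the single bit. [folklore] -/
theorem qReg_one_eq_iff (u v : QReg 1) : u = v ↔ u 0 = v 0 :=
  ⟨fun h => by rw [h], fun h => funext fun i => by rw [Subsingleton.elim i 0]; exact h⟩

/-- `(1/√2)·(1/√2) = 1/2` in `ℂ`. [folklore] -/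
theorem invSqrt2C_mul_self : (1 / (Real.sqrt 2 : ℂ)) * (1 / (Real.sqrt 2 : ℂ)) = 1 / 2 := by
  rw [div_mul_div_comm, one_mul, ← Complex.ofReal_mul, Real.mul_self_sqrt (by norm_num : (0 : ℝ) ≤ 2)]
  norm_num

/-- **`2 · H ⊗ H̄` on bits**: `2 · H_{u,v} conj H_{u',v'} = (-1)^{vu + v'u'}`. [cite: NielsenChuang2010, §4.2 (H)] -/
theorem val_evalH_eq (u v u' v' : QReg 1) :
    ZOmega.val (if ((v 0 && u 0) ^^ (v' 0 && u' 0)) then -1 else 1) =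
      2 * (hGate u v * starRingEnd ℂ (hGate u' v')) := by
  have hconj : ∀ x y : QReg 1, starRingEnd ℂ (hGate x y) = hGate x y := by
    intro x y
    simp only [hGate, Matrix.of_apply]
    split_ifs <;> simp [Complex.conj_ofReal]
  rw [hconj]
  have key : ∀ p q : Bool, ZOmega.val (if (p ^^ q) then -1 else 1) =
      2 * ((if p then -(1 / (Real.sqrt 2 : ℂ)) else 1 / (Real.sqrt 2 : ℂ)) *
        (if q then -(1 / (Real.sqrt 2 : ℂ)) else 1 / (Real.sqrt 2 : ℂ))) := by
    have h2 := invSqrt2C_mul_self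
    intro p q
    cases p <;> cases q <;> simp only [Bool.xor_false, Bool.xor_true, Bool.not_false,
      Bool.not_true, if_true, if_false, Bool.false_eq_true, map_one, map_neg, neg_mul, mul_neg, neg_neg] <;>
      rw [h2] <;> norm_num
  simp only [hGate, Matrix.of_apply]
  convert key (v 0 && u 0) (v' 0 && u' 0) using 3 <;> simp [Bool.and_comm]

/-- `ω² = i`, `ω⁶ = -i`, `ω⁷ = conj ω` and `ω⁸ = 1`, as `val` of powers of `om`. [folklore] -/
theorem val_om_pow (k : ℕ) : ZOmega.val (NodeRec.om ^ k) = omega ^ k := by rw [map_pow, NodeRec.val_om]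

/-- **`S ⊗ S̄` on bits.** [cite: NielsenChuang2010, §4.2 (S)] -/
theorem val_evalS_eq (u v u' v' : QReg 1) :
    ZOmega.val (if v 0 = u 0 ∧ v' 0 = u' 0 then
        NodeRec.om ^ (2 * (if v 0 then 1 else 0) + 6 * (if v' 0 then 1 else 0)) else 0) =
      sGate u v * starRingEnd ℂ (sGate u' v') := by
  have h2 : omega ^ 2 = Complex.I := omega_pow_two
  have h6 : omega ^ 6 = -Complex.I := by
    rw [show (6 : ℕ) = 4 + 2 by rfl, pow_add, omega_pow_four, h2]; ring
  have h8 : omega ^ 8 = 1 := omega_pow_eight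
  simp only [sGate, Matrix.of_apply, qReg_one_eq_iff]
  cases hu : u 0 <;> cases hv : v 0 <;> cases hu' : u' 0 <;> cases hv' : v' 0 <;>
    simp [val_om_pow, h2, h6, h8, Complex.conj_I]

/-- **`T ⊗ T̄` on bits.** [cite: NielsenChuang2010, §4.2 (T)] -/
theorem val_evalT_eq (u v u' v' : QReg 1) :
    ZOmega.val (if v 0 = u 0 ∧ v' 0 = u' 0 then
        NodeRec.om ^ ((if v 0 then 1 else 0) + 7 * (if v' 0 then 1 else 0)) else 0) =
      tGate u v * starRingEnd ℂ (tGate u' v') := by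
  have h7 : starRingEnd ℂ omega = omega ^ 7 := by rw [← star_omega]; rfl
  have h17 : omega * omega ^ 7 = 1 := by rw [← pow_succ', omega_pow_eight]
  have h8 : omega ^ 8 = 1 := omega_pow_eight
  have hexp : Complex.exp (Real.pi / 4 * Complex.I) = omega := rfl
  simp only [tGate, Matrix.of_apply, qReg_one_eq_iff, hexp]
  cases hu : u 0 <;> cases hv : v 0 <;> cases hu' : u' 0 <;> cases hv' : v' 0 <;>
    simp [h7, h17, h8]

/-- **`CNOT ⊗ CNOT` on bits.** [cite: NielsenChuang2010, §4.3 (CNOT)] -/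
theorem val_evalCNOT_eq (u v u' v' : QReg 2) :
    ZOmega.val (if (u 0 = v 0 ∧ u 1 = (v 1 ^^ v 0)) ∧ (u' 0 = v' 0 ∧ u' 1 = (v' 1 ^^ v' 0)) then 1 else 0) =
      cnot u v * starRingEnd ℂ (cnot u' v') := by
  simp only [cnot, Matrix.of_apply]
  by_cases h1 : u 0 = v 0 ∧ u 1 = (v 1 ^^ v 0) <;> by_cases h2 : u' 0 = v' 0 ∧ u' 1 = (v' 1 ^^ v' 0) <;>
    simp [h1, h2]

/-- **The record entry is the tensor entry, rescaled**: read through `val`, the entry of the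
record of the node `u` at the encoded assignment is `recWeight C u` times the entry of the segment
network at `u` (oracle-free circuits). [cite: MarkovShi2008, §3 (Def 3.2, Def 3.4, the network N(C; x, τ))] -/
theorem val_eval_recOf (hC : C.IsOracleFree) (A : Language Bool) (z₀ : QReg N) (w₀ : Fin N)
    (u : CircuitNode C.gates.length N) (g : Seg C → Bool × Bool) :
    ZOmega.val ((recOf C z₀ w₀ u).eval (encodeAssign (segIdx C) domCode g)) =
      recWeight C u * (segmentNetwork C A z₀ (obsOf w₀)).entry u g := by
  cases u with
  | input w =>
    simp only [recOf, NodeRec.eval, ketOf_enc, braOf_enc, recWeight, one_mul]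
    show _ = (if g (segAt C w 0) = (z₀ w, z₀ w) then (1 : ℂ) else 0)
    simp only [ketAt, braAt]
    obtain ⟨k, hk⟩ : ∃ k, (g (segAt C w 0)).1 = k := ⟨_, rfl⟩
    obtain ⟨b, hb⟩ : ∃ b, (g (segAt C w 0)).2 = b := ⟨_, rfl⟩
    have hp : g (segAt C w 0) = (k, b) := Prod.ext hk hb
    simp only [hp]
    cases k <;> cases b <;> cases z₀ w <;> simp
  | output w =>
    simp only [recOf, NodeRec.eval, ketOf_enc, braOf_enc, recWeight, one_mul, decide_eq_true_eq]
    show _ = (if (g (segAt C w (Fin.last _))).1 = (g (segAt C w (Fin.last _))).2 then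
      obsOf w₀ w (g (segAt C w (Fin.last _))).1 else 0)
    simp only [ketAt, braAt, obsOf]
    obtain ⟨k, hk⟩ : ∃ k, (g (segAt C w (Fin.last _))).1 = k := ⟨_, rfl⟩
    obtain ⟨b, hb⟩ : ∃ b, (g (segAt C w (Fin.last _))).2 = b := ⟨_, rfl⟩
    simp only [hk, hb]
    by_cases hw : w = w₀ <;> cases k <;> cases b <;> simp [hw]
  | gate t =>
    have hof : (C.gates[(t : ℕ)]).IsOracleFree := hC _ (List.getElem_mem _)
    rcases hg : C.gates[(t : ℕ)] with ⟨op, e⟩ | ⟨k, e⟩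
    · rw [entry_gate_eq A z₀ (obsOf w₀) g t hg]
      cases op
      · simp only [recOf, hg, recWeight, NodeRec.eval, ketOf_enc, braOf_enc]
        exact val_evalH_eq (fun j => ketAt g t.succ (e j)) (fun j => ketAt g t.castSucc (e j))
          (fun j => braAt g t.succ (e j)) (fun j => braAt g t.castSucc (e j))
      · simp only [recOf, hg, recWeight, NodeRec.eval, ketOf_enc, braOf_enc, one_mul]
        exact val_evalS_eq (fun j => ketAt g t.succ (e j)) (fun j => ketAt g t.castSucc (e j))
          (fun j => braAt g t.succ (e j)) (fun j => braAt g t.castSucc (e j))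
      · simp only [recOf, hg, recWeight, NodeRec.eval, ketOf_enc, braOf_enc, one_mul]
        exact val_evalT_eq (fun j => ketAt g t.succ (e j)) (fun j => ketAt g t.castSucc (e j))
          (fun j => braAt g t.succ (e j)) (fun j => braAt g t.castSucc (e j))
      · simp only [recOf, hg, recWeight, NodeRec.eval, ketOf_enc, braOf_enc, one_mul]
        exact val_evalCNOT_eq (fun j => ketAt g t.succ (e j)) (fun j => ketAt g t.castSucc (e j))
          (fun j => braAt g t.succ (e j)) (fun j => braAt g t.castSucc (e j))
    · rw [hg] at hof; exact absurd hof id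

/-- Every rescaling constant is `1` or `2`. [folklore] -/
theorem recWeight_eq_one_or (C : QCircuit cliffordT N) (u : CircuitNode C.gates.length N) :
    recWeight C u = 1 ∨ recWeight C u = 2 := by
  rcases u with w | t | w
  · left; rfl
  · rcases hg : C.gates[(t : ℕ)] with ⟨op, e⟩ | ⟨k, e⟩
    · cases op
      · right; simp only [recWeight, hg]
      all_goals left; simp only [recWeight, hg]
    · left; simp only [recWeight, hg]
  · left; rfl

/-- The product of the rescaling constants is a power of two: `2^{#Hadamard nodes}`. [folklore] -/
theorem prod_recWeight_eq (C : QCircuit cliffordT N) :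
    ∏ u, recWeight C u = 2 ^ (Finset.univ.filter fun u => recWeight C u = 2).card := by
  classical
  rw [← Finset.prod_filter_mul_prod_filter_not Finset.univ (fun u => recWeight C u = 2)]
  rw [Finset.prod_congr rfl (fun u hu => (Finset.mem_filter.1 hu).2), Finset.prod_const,
    Finset.prod_eq_one (fun u hu => ?_), mul_one]
  exact (recWeight_eq_one_or C u).resolve_right (Finset.mem_filter.1 hu).2

/-- **The list network of a Clifford+T circuit has the value of its segment network, rescaled**:
`val (netValue) = (∏ recWeight) · value` (oracle-free circuits). [cite: MarkovShi2008, §3 (eq. (1), Prop 3.5)] -/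
theorem val_netValue_recList (hC : C.IsOracleFree) (A : Language Bool) (z₀ : QReg N) (w₀ : Fin N) :
    ZOmega.val (netValue NodeRec.recOps (segCount C) 4 (recList C z₀ w₀)) =
      (∏ u, recWeight C u) * (segmentNetwork C A z₀ (obsOf w₀)).value := by
  classical
  exact map_netValue_eq_mul_value ZOmega.val (segmentNetwork C A z₀ (obsOf w₀)) NodeRec.recOps (segIdx C) domCode
    (recOf C z₀ w₀) (nodeList C.gates.length N) (nodup_nodeList _ _) mem_nodeList (recWeight C)
    (fun u g => val_eval_recOf hC A z₀ w₀ u g)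

/-- **… hence it is the rescaled acceptance probability** (Prop. 3.5): for a circuit on `n + m`
wires run on `|x⟩|0^m⟩` with wire `0` measured,
`val (netValue) = (∏ recWeight) · P[wire 0 reads 1]`. [cite: MarkovShi2008, §3 (Prop 3.5)] -/
theorem val_netValue_recList_eq_acceptProb {n m : ℕ} {C : QCircuit cliffordT (n + m)} (hC : C.IsOracleFree)
    (A : Language Bool) (x : QReg n) (h : 0 < n + m) :
    ZOmega.val (netValue NodeRec.recOps (segCount C) 4 (recList C (padInput x m) ⟨0, h⟩)) =
      (∏ u, recWeight C u) * (C.acceptProb A x : ℂ) := by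
  rw [val_netValue_recList hC A, acceptProb_eq_value_segmentNetwork A C x h]
  rfl

end Entries

end Literature.Barriers.QuantumAdvantage

end
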